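import Summits.BirchSwinnertonDyer.Rank1Residual.O5.O5ThreeAdicCostLaw
import HarnessLib

/-!
# O5 — GEN 12: the RATIONAL-3-TORSION COST LAW (T29) — the exact 3-adic cost of the Selmer transfer on the
# class-01 rows (`h⁰(ℚ₃, W[3]) = 1`), the FLAT KUMMER LINE law of the tame cell, and the census P-K18

Add-on to GEN 10's `O5TransferCertificate` (T27, grade α⁺; typing p303410) and GEN 11's `O5ThreeAdicCostLaw` (T28,
grade β for `h⁰₃ = 0`; typing ask A-O5-26).  Census cell O5 = (t′), o5-r1 GEN 12 (planner-b2b-bsdres-o5-r1-g12-0,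
2026-08-21).  Informal text of record: `HOME/b2b-bsdres-o5-r1/gen12/T29-RATIONAL-TORSION-COST-LAW.md`; pre-registration
`gen12/P-K18-PREREG.md` (sha16 009ffa4f53388f57, frozen before any run; frozen scorer `score18.py` 17ecd30090151ee6).

HONEST FRAMING (cell `b2b-bsdres`): research route, lane CLASS-CLOSURE (`CLASS-CLOSURE-PLAN.md` §3.5 O5), experiment types
(1) statement discovery with held-out validation, (2) obstruction anatomy, (3) transport.  Every node below is a
`def … : Prop` tagged `@[conjecture]` (THEOREM-CANDIDATE with a written proof in T29 §1, or a census law); the links are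
PROVED bookkeeping.  Nothing is asserted, nothing booked, no mark of `RESIDUAL-MAP.md` moves, NO Literature fact is minted;
census numbers are EVIDENCE; no main conjecture, no `L`-value, no Selmer group and no class group enters any computation
(the BSD-read Selmer intervals of record are used only as DATA in the falsification test K18-d).

## The statement in one paragraph (T29)
Let `E/ℚ₃` have a `ℚ₃`-rational point `P₀` of order `3` and non-split `E[3]` (class 01: `C = ⟨P₀⟩ ≅ 𝟙`, `E[3]/C ≅ μ₃`).
Then `H = H¹(ℚ₃, E[3])` is a HYPERBOLIC quadratic `𝔽₃`-space of dimension `4` in which `κ = E(ℚ₃)/3` and `L_C = H¹(ℚ₃, C)`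
are Lagrangian planes.  Put `k := dim E(ℚ₃)/φ̂E′(ℚ₃)` (`φ : E → E′ = E/C`; by Schaefer's index formula
`k = a(φ̂) + log₃ c₃(E)/c₃(E′)`, Dokchitser–Dokchitser arXiv:1208.5519 Lemma 10) and `t := im δ_φ̂ ⊂ H¹(ℚ₃, μ₃) = ℚ₃^×/ℚ₃^{×3}`
(the cube classes of the TANGENT-LINE values `f_{P₀}(P) = y − y₀ − m₀(x − x₀)`, `div f = 3(P₀) − 3(O)`); `dim t = k`,
`dim(κ ∩ L_C) = 2 − k`.  T29.1: `k = 0 ⟺ κ = L_C`; `k = 1 ⟹ κ` is the UNIQUE Lagrangian `≠ L_C` through the line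
`ι_*(t^⊥)` (two Lagrangians through an isotropic line, one per ruling); `k = 2 ⟺ κ ∩ L_C = 0`.  T29.2 (pair cost, the exact
3-adic summand of T27's transfer for a congruent pair): `(k_W,k_G) = (0,0) ↦ 0; (0,1),(1,0),(1,2),(2,1) ↦ 1; (0,2),(2,0) ↦ 2;
(1,1) ↦ 2·[t_W ≠ t_G]`.  Census P-K18 (kit j141130/j141165, 9 039 curves, 13 327 pairs, 0 errors): `dim t = k` and
`δ_φ̂(P₀) = ±[E′[3]]` on 9 039/9 039; (b1) type III: `E′ = III*`, `c = c′ = 2`, `a(φ̂) = 1`, `k = 1` on 2 251/2 251; (b2) `Iₙ*`: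
`k = 0` on 2 574/2 574; (b3) `I₀*` pot-ordinary: `k = 0` on 2 125/2 125; DISCOVERED and held-out validated: `t = U` (the unit =
fppf-flat line) on EVERY class-01 type-III curve (2 251/2 251; FIT 1 108 → VALIDATE 1 143, 0 exceptions) — T29.6; wild
companions: `II`: `k = 1 − [c′ = 3]`, `t = U` when `k = 1`; `IV`: `k = 2 − [c′ = 3]`, `t = ⟨12·(c₆/3⁵)²⟩` (très ramifié) when
`k = 1` — T29.7.  Hence on the whole universe the cost is a function γ of the COMPANION'S local type: `γ(III) = γ(II, c′=1) = 0`,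
`γ(Iₙ*) = γ(I₀*) = γ(II, c′=3) = γ(IV, c′=1) = 1`, `γ(IV, c′=3) = 2`, and `|dim Sel₃ W − dim Sel₃ G| ≤ D_α⁺ − 2 + γ(G)` has
0 violations against the BSD-read intervals on 13 327 pairs (2 756 of which force cost ≥ 1 and 99 force cost = 2 — all in the
right cells).  Reach: 100 of the 212 open `h03 = 1` rows get a λ-grade certificate; residual 112 with named reasons.

## TYPER PLACEMENT NOTE (cc-typer-5 GEN 10 = O5 §3.5 / O6 §3.4 typer of record; ask A-O5-27 of o5-r1 GEN 12,
## `HOME/INBOX.md` 2026-08-21T22:20Z "type gen12 Lean after A-O5-26; `awayBudgetThree` = gen11 `betaBudgetThree`, merge")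

HONEST FRAMING as above (research route; nodes = `@[conjecture] def … : Prop`, EVIDENCE-labelled; census = EVIDENCE, never a
Literature fact; nothing asserted, nothing booked; no mark of `RESIDUAL-MAP.md` moves; NO Literature fact minted; O5 OPEN;
the wild rows are O6's — T29.7 is typed on COMPANIONS only, as o5-r1 wrote). PROVENANCE: module text above this note and every
declaration below = o5-r1 GEN 12's `HOME/b2b-bsdres-o5-r1/gen12/O5RationalTorsionCostLaw.lean` (sha16 `5fc7e4bc83c4d9fc`, 288 l.;
write-up `gen12/T29-RATIONAL-TORSION-COST-LAW.md`; pre-registration `gen12/P-K18-PREREG.md`, frozen scorer `score18.py`; kit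
j141130 / j141165) with exactly TWO typer changes: (i) the import is `O5.O5ThreeAdicCostLaw` (A-O5-26, which imports
`O5UncleanParity`) and (ii) the MERGE — o5-r1's `def awayBudgetThree` (byte-identical body to GEN 11's `betaBudgetThree`) is NOT
re-declared; the four pair statements read `betaBudgetThree W G`. Everything else BYTE-IDENTICAL. TYPER READINGS (no statement
touched): (a) `RamifiedLineNeverFlatThree` is CLOSED IN-FILE by `ramifiedLineNeverFlatThree_holds` (definitional consistency of
the datum predicates; the audit's proof-of-item) — the EVIDENCE law T29.7 (b) proper ("IV with `c₃(G′) = 3` ⇒ `t` très ramifié,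
`t = ⟨12·(c₆/3⁵)²⟩`") is NOT typed (no Kodaira-IV / `E′` vocabulary yet), exactly as o5-r1 says; (b) KERNEL NEIGHBOURS already in
the tree (cross-cell pool hands, this lane's first refusal honoured): Lemma L / T29.1–T29.2 as field-general linear algebra —
x11b3-p8 GEN 19 `O5/LagrangianDatumLinearAlgebra.lean` p308396 (`LagrangianDatum.eq_or_eq_of_le` "exactly two Lagrangians through
a corank-one isotropic subspace, one per ruling", `finrank_inf_mod_two` = the parity behind `LagDatumThree.cost_parity`,
`eq_iff_inf_eq_inf` = T29.1 (ii), `exists_pair_of_isTotallyIsotropic`); the 3-adic algebra of T29.6's unit half — x11b3-p7 GEN 13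
`O5/ThreeTorsionNormalFormKummer.lean` p308301 (`exists_point_not_cube`, `not_exists_pow_three_eq_of_specialCondition`) and the flat
half `O5/ThreeTorsionNormalFormValuation.lean` (its `IsFlatClassAtThree y` reading). None of them is imported here (statements stay
o5-r1's). DEDUP (tree grep on all 27 top-level names + `LagDatumThree.*`: no declaration match; four names occur only in those two
files' docstrings). Bib: `DokchitserDokchitser2015LocalInvariantsIsogenous` (Trans. AMS 367 (2015), arXiv:1208.5519) and
`BKLS2019ThreeIsogenySelmer` (Duke 168 (2019), arXiv:1709.09790) ADDED by the typer; the others present. CHECK: farm `lean check`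
rc 0 / 0 warnings / 0 sorries. STATUS ⟦cc-typer-5 GEN 17, docket cc-lead ⟦gen66⟧ (2′) rider (r3)⟧: T29.6 + (b1) `FlatKummerImageTypeIIIThree` PROVED AS TYPED by n1011-p18 GEN 14,
`flatKummerImageTypeIIIThree_holds` (`O5/FlatKummerImageTypeIIIThreeProofs.lean`, p337946 ACCEPTED; over the flex tangent normal form `O5/FlexTangentNormalFormThree.lean` p336908);
its `@[conjecture]` attribute DROPPED here, statement bytes unchanged; the four other nodes (`TrivialKummerImagePotTwistThree`, `SelmerTransferFlatPairThree`,
`SelmerTransferOddPairThree`, `RamifiedLineNeverFlatThree`) untouched. STATUS ⟦cc-typer-5 GEN 18, rider (r12)⟧: T29.4 (b2)/(b3) `TrivialKummerImagePotTwistThree` PROVED AS TYPED by n1011-p18 GEN 16 (`FlexTangent.trivialKummerImagePotTwistThree_holds`,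
`O5/TrivialKummerImagePotTwistThreeProofs.lean` p347752); its `@[conjecture]` attribute DROPPED, statement bytes unchanged; `@[conjecture]` × 3 now (`SelmerTransferFlatPairThree`, `SelmerTransferOddPairThree`,
`RamifiedLineNeverFlatThree`).
-/

noncomputable section

open scoped Classical

open Polynomial WeierstrassCurve Literature.NumberTheory.EllipticCurves
  Literature.NumberTheory.EllipticCurves.Rank1Residual
  Summit.BirchSwinnertonDyer.Rank1Residual.Additive

namespace Summit.BirchSwinnertonDyer.Rank1Residual.O5

/-! ## §0 Decidable vocabulary: the rational 3-torsion point, the tangent-line values, cube classes -/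

/-- **A `ℚ₃`-rational point of exact order `3`**: an affine point of `W/ℚ₃` whose `x`-coordinate is a root of `Ψ₃`
(census: local class `01` when `Ψ₃` has exactly one `ℚ₃`-root). [folklore] -/
def IsRationalThreeTorsionPointAtThree (W : WeierstrassCurve ℚ) (x₀ y₀ : ℚ_[3]) : Prop :=
  (W.baseChange ℚ_[3]).toAffine.Equation x₀ y₀ ∧ (W.baseChange ℚ_[3]).Ψ₃.IsRoot x₀

/-- `h⁰(ℚ₃, W[3]) ≥ 1`: some `ℚ₃`-rational point of order `3`. [folklore] -/
def HasRationalThreeTorsionAtThree (W : WeierstrassCurve ℚ) : Prop :=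
  ∃ x₀ y₀ : ℚ_[3], IsRationalThreeTorsionPointAtThree W x₀ y₀

/-- **The tangent-line value** `f_{P₀}(P) = y − y₀ − m₀ (x − x₀)` at `P₀ = (x₀, y₀)` of order `3`
(`m₀` = tangent slope; `div f = 3(P₀) − 3(O)` because the third intersection of the tangent is `−2P₀ = P₀`).  For
`P ∉ {O, P₀}` the local `φ̂`-Kummer map is `δ_φ̂(P) = f_{P₀}(P) · ℚ₃^{×3}` (descent via 3-isogeny, [Silverman AEC X.4];
census check K18-a: the span of these classes has dimension `k` on 9 039/9 039 curves). [folklore] -/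
def tangentValueAtThree (W : WeierstrassCurve ℚ) (x₀ y₀ x y : ℚ_[3]) : ℚ_[3] :=
  y - y₀ - (3 * x₀ ^ 2 + 2 * (W.baseChange ℚ_[3]).a₂ * x₀ + (W.baseChange ℚ_[3]).a₄ - (W.baseChange ℚ_[3]).a₁ * y₀) /
      (2 * y₀ + (W.baseChange ℚ_[3]).a₁ * x₀ + (W.baseChange ℚ_[3]).a₃) * (x - x₀)

/-- `z` is a cube in `ℚ₃` (trivial class in `ℚ₃^×/ℚ₃^{×3} ≅ 𝔽₃²`). [folklore] -/
def IsCubeAtThree (z : ℚ_[3]) : Prop := ∃ w : ℚ_[3], z = w ^ 3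

/-- `z ≠ 0` has a FLAT (= unit, "peu ramifié") cube class: `3 ∣ v₃(z)`, i.e. `z ∈ ℤ₃^× · ℚ₃^{×3}`; the flat classes form
the line `U = ⟨2⟩ = H¹_fppf(ℤ₃, μ₃)` of the plane `ℚ₃^×/ℚ₃^{×3}` (the other three lines `⟨3⟩, ⟨6⟩, ⟨12⟩` are très
ramifié). [folklore] -/
def IsFlatClassAtThree (z : ℚ_[3]) : Prop := z ≠ 0 ∧ (3 : ℤ) ∣ Padic.valuation z

/-- `t ⊆ U`: every tangent value at a point with `x ≠ x₀` is flat. [folklore] -/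
def KummerImageFlatAtThree (W : WeierstrassCurve ℚ) (x₀ y₀ : ℚ_[3]) : Prop :=
  ∀ x y : ℚ_[3], (W.baseChange ℚ_[3]).toAffine.Equation x y → x ≠ x₀ →
    IsFlatClassAtThree (tangentValueAtThree W x₀ y₀ x y)

/-- `t ∋` a unit class: some tangent value is flat and NOT a cube (with `KummerImageFlatAtThree`: `t = U`, `k = 1`). [folklore] -/
def KummerImageHasUnitAtThree (W : WeierstrassCurve ℚ) (x₀ y₀ : ℚ_[3]) : Prop :=
  ∃ x y : ℚ_[3], (W.baseChange ℚ_[3]).toAffine.Equation x y ∧ x ≠ x₀ ∧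
    IsFlatClassAtThree (tangentValueAtThree W x₀ y₀ x y) ∧ ¬ IsCubeAtThree (tangentValueAtThree W x₀ y₀ x y)

/-- `t ∋` a ramified class: some tangent value has valuation `≢ 0 (mod 3)`. [folklore] -/
def KummerImageHasRamifiedAtThree (W : WeierstrassCurve ℚ) (x₀ y₀ : ℚ_[3]) : Prop :=
  ∃ x y : ℚ_[3], (W.baseChange ℚ_[3]).toAffine.Equation x y ∧ x ≠ x₀ ∧
    ¬ (3 : ℤ) ∣ Padic.valuation (tangentValueAtThree W x₀ y₀ x y)

/-- `t = 0` (`k = 0`, `κ = L_C`): every tangent value is a cube. [folklore] -/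
def KummerImageTrivialAtThree (W : WeierstrassCurve ℚ) (x₀ y₀ : ℚ_[3]) : Prop :=
  ∀ x y : ℚ_[3], (W.baseChange ℚ_[3]).toAffine.Equation x y → x ≠ x₀ → IsCubeAtThree (tangentValueAtThree W x₀ y₀ x y)

/-- **The Lagrangian datum, type `(1, U)`**: a rational 3-torsion point whose Kummer image is EXACTLY the flat line. [folklore] -/
def HasFlatLineKummerImageAtThree (W : WeierstrassCurve ℚ) : Prop :=
  ∃ x₀ y₀ : ℚ_[3], IsRationalThreeTorsionPointAtThree W x₀ y₀ ∧
    KummerImageFlatAtThree W x₀ y₀ ∧ KummerImageHasUnitAtThree W x₀ y₀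

/-- **Type `(0, 0)`**: a rational 3-torsion point with trivial Kummer image (`κ = L_C`). [folklore] -/
def HasTrivialKummerImageAtThree (W : WeierstrassCurve ℚ) : Prop :=
  ∃ x₀ y₀ : ℚ_[3], IsRationalThreeTorsionPointAtThree W x₀ y₀ ∧ KummerImageTrivialAtThree W x₀ y₀

/-- **Type `(2, plane)`**: the Kummer image is the whole plane (a ramified AND a unit class; `κ ∩ L_C = 0`). [folklore] -/
def HasFullKummerImageAtThree (W : WeierstrassCurve ℚ) : Prop :=
  ∃ x₀ y₀ : ℚ_[3], IsRationalThreeTorsionPointAtThree W x₀ y₀ ∧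
    KummerImageHasRamifiedAtThree W x₀ y₀ ∧ KummerImageHasUnitAtThree W x₀ y₀

/-- **Type `(1, R)`** (très ramifié line): a ramified class, and no unit class. [folklore] -/
def HasRamifiedLineKummerImageAtThree (W : WeierstrassCurve ℚ) : Prop :=
  ∃ x₀ y₀ : ℚ_[3], IsRationalThreeTorsionPointAtThree W x₀ y₀ ∧
    KummerImageHasRamifiedAtThree W x₀ y₀ ∧ ¬ KummerImageHasUnitAtThree W x₀ y₀

/-! **The away-from-3 budget** of the T29 write-up (`awayBudgetThree` in o5-r1's draft: T27's `crudeBudgetThree` with the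
3-adic term `1 + h⁰₃` REMOVED) is IDENTICAL to GEN 11's `betaBudgetThree` (`O5/O5ThreeAdicCostLaw.lean`, imported) — MERGED by
the typer as o5-r1 GEN 12 asked ("`awayBudgetThree` = gen11 `betaBudgetThree`, merge"): every occurrence below reads
`betaBudgetThree`; no second declaration. -/

/-! ## §1 The per-curve laws (k, t) by local type -/

/-- **T29.6 + (b1) `FlatKummerImageTypeIIIThree` — THEOREM: PROVED AS TYPED by n1011-p18 GEN 14, `flatKummerImageTypeIIIThree_holds` (`O5/FlatKummerImageTypeIIIThreeProofs.lean`,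
p337946 ACCEPTED; Tate's algorithm at `3` on the flex tangent normal form + `SubTprime ⇒ III ∨ III*`, `III*` excluded by `ord₃ Δ_min`; binders verbatim, axioms standard); `@[conjecture]` DROPPED
⟦cc-typer-5 GEN 17, rider (r3) of cc-lead ⟦gen66⟧ (2′)⟧, statement bytes unchanged; census = EVIDENCE; a `_holds` closes no pair; O5 OPEN.**  (As typed: EVIDENCE law,
discovered-then-validated, o5-r1 GEN 12.)  Every O5(t′)
curve `W` of Kodaira type III at `3` (`v₃Δ = 3`) with ONE stable line and a `ℚ₃`-RATIONAL 3-torsion point (class 01) has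
Lagrangian datum `(k, t) = (1, U)`: all tangent-line values are flat and one is a non-cube.  The `k = 1` half is
THEOREM-CANDIDATE (T29 §1 (b1): `W′ = III*`, `c₃ = c₃′ = 2`, `a(φ̂) = 1`, Schaefer's formula); the `t = U` half is the
census DISCOVERY (prior expectation was "not a function of local invariants").  Heuristic: `W′` has good reduction over a
TAME quartic extension, over which `W′[3]` is finite flat, forcing `v₃` of its Kummer class `≡ 0 (mod 3)` (peu ramifié);
caveat `e = 4 > p − 1` (non-unique finite-flat models) — hence EVIDENCE.  Why it might fail: a class-01 III curve outside the
congruence universe with a très ramifié tangent value (first computation C-29a of T29 §5 checks all of conductor < 500 000).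
[cite: DokchitserDokchitser2015LocalInvariantsIsogenous, Lemma 10 and Table 1 (arXiv:1208.5519 pp. 3, 7)]
[cite: BKLS2019ThreeIsogenySelmer, Thm. 10.5 (arXiv:1709.09790 p. 15)]
[evidence: census cell O5, o5-r1 GEN 12, P-K18 kit j141165 (pre-registered gen12/P-K18-PREREG.md 009ffa4f53388f57, frozen scorer 17ecd30090151ee6): 2 251/2 251 class-01 type-III curves have (kod(W′), c, c′, a(φ̂), k) = (III*, 2, 2, 1, 1) and t = U; hash-split discovery FIT 1 108 pure → VALIDATE 1 143, 0 exceptions; instrument checks dim t = k and δ(P₀) = ±[W′[3]] 9 039/9 039 — T29-RATIONAL-TORSION-COST-LAW.md §3] -/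
def FlatKummerImageTypeIIIThree : Prop :=
  ∀ (W : WeierstrassCurve ℚ) [W.IsElliptic] [W.IsGloballyMinimal],
    ClassO5 W 3 → SubTprime W 3 → padicValRat 3 W.Δ = 3 → numStableLinesAtThree W = 1 →
      ∀ x₀ y₀ : ℚ_[3], IsRationalThreeTorsionPointAtThree W x₀ y₀ →
        KummerImageFlatAtThree W x₀ y₀ ∧ KummerImageHasUnitAtThree W x₀ y₀

/-- **T29.4 (b2)/(b3) class 01 `TrivialKummerImagePotTwistThree` — THEOREM: PROVED AS TYPED by n1011-p18 GEN 16, `FlexTangent.trivialKummerImagePotTwistThree_holds`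
(`O5/TrivialKummerImagePotTwistThreeProofs.lean`, p347752 ACCEPTED; tools `O5/FlexCubeResidueClassesThree.lean` p346595 → `O5/FlexTrivialCubeClassThree.lean` p347094; method: Kodaira dictionary at `3` ⇒ `v₃c₄ = 2 ∧ v₃Δ ≥ 6`, GEN 14 FILE A flex form,
3-adic shape lemma, residue classes ⇒ every tangent value a cube — the node's 'named gap' (invariance of `a(φ)` under the ramified quadratic twist)
is BYPASSED, the binder `numStableLinesAtThree X = 1` kept as typed though unused; binders verbatim, axioms standard); `@[conjecture]` DROPPED
⟦cc-typer-5 GEN 18, rider (r12) of cc-lead ⟦gen71⟧ (2′) / n1011 lead R5-174; typer fidelity word INBOX l.13450⟧, statement bytes unchanged;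
census = EVIDENCE; a `_holds` closes no pair; O5 OPEN.**
**(As typed: THEOREM-CANDIDATE, o5-r1 GEN 12; proof T29 §1 = T28 Lemma 5 twisted by `(ω, 𝟙)`).**  An additive curve at `3` that is potentially multiplicative (`Iₙ*`) or tame potentially ORDINARY
(`I₀*`), with one stable line and a `ℚ₃`-rational 3-torsion point, has `k = 0`: every tangent-line value is a cube
(`κ = L_C`; `a(φ̂) = 0`, `c₃ = c₃′`).  Why it might fail: the invariance of `a(φ)` under the ramified quadratic twist of both
sides (named gap, routine).
[cite: DokchitserDokchitser2015LocalInvariantsIsogenous, Prop. 16–18 (arXiv:1208.5519 p. 8)]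
[evidence: census cell O5, o5-r1 GEN 12, P-K18 kit j141165: Iₙ* 2 574/2 574 and I₀* 2 125/2 125 class-01 companions have (a(φ̂), c = c′, k, t) = (0, true, 0, 0), W′ = I₃ₙ* resp. I₀*, W′[3] split — T29 doc §3] -/
def TrivialKummerImagePotTwistThree : Prop :=
  ∀ (X : WeierstrassCurve ℚ) [X.IsElliptic] [X.IsGloballyMinimal],
    Addv X 3 → (SubM X 3 ∨ SubGordOrd X 3) → numStableLinesAtThree X = 1 →
      ∀ x₀ y₀ : ℚ_[3], IsRationalThreeTorsionPointAtThree X x₀ y₀ → KummerImageTrivialAtThree X x₀ y₀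

/-! ## §2 The pair laws: the 3-adic cost from the Lagrangian data (T29.2 / T29-λ) -/

/-- **T29-λ, γ = 0 `SelmerTransferFlatPairThree` (THEOREM-CANDIDATE given T27, o5-r1 GEN 12; proof T29.1 (ii) + T29.2 case
(1,1) with equal lines).**  For a mod-3 congruent pair with `W[3]` irreducible, ONE stable line at `3` on both sides and
Lagrangian data `(1, U)` on BOTH sides, the two Kummer planes at `3` COINCIDE (each is the unique Lagrangian `≠ L_C` through
`ι_*(U^⊥)`), so the 3-adic term of the transfer vanishes: the 3-Selmer dimensions differ by at most the away-from-3 budget.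
`G` may be tame (III) or WILD (II with `c₃(G′) = 1`).  Why it might fail: only through T27 / the tangent-value dictionary
`δ_φ̂ = f_{P₀} mod cubes`.
[cite: MazurRubin2015SelmerCompanions, §2–§3 (arXiv:1203.0620)] [cite: PoonenRains2012, Prop. 4.11]
[evidence: census cell O5, o5-r1 GEN 12, P-K18 kit j141165, K18-d: BSD-read two-sided Selmer intervals vs D_β = D_α⁺ − 2 on the 3 345 kept pairs of type (1,U)~(1,U) (III~III 2 496, III~II(c′=1) 849): 0 violations, none needs a larger budget; λ-certificates: 100 open h03=1 rows newly reached, all through such pairs — T29 doc §3] -/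
@[conjecture] def SelmerTransferFlatPairThree : Prop :=
  ∀ (W G : WeierstrassCurve ℚ) [W.IsElliptic] [W.IsGloballyMinimal] [G.IsElliptic] [G.IsGloballyMinimal],
    W.HasIrreducibleModPGaloisRep 3 → IsCongruentModThree W G →
    numStableLinesAtThree W = 1 → numStableLinesAtThree G = 1 →
    HasFlatLineKummerImageAtThree W → HasFlatLineKummerImageAtThree G →
      selmerDimThree W ≤ selmerDimThree G + betaBudgetThree W G ∧
        selmerDimThree G ≤ selmerDimThree W + betaBudgetThree W G

/-- **T29-λ, γ = 1 `SelmerTransferOddPairThree` (THEOREM-CANDIDATE given T27; proof T29.2 cases (1,0), (1,2): Lagrangians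
of different rulings meet in a line).**  `W` with datum `(1, U)`, `G` congruent with one stable line and datum `(0, 0)`
(`Iₙ*`, `I₀*`-ordinary, `II` with `c₃(G′) = 3`) or `(2, plane)` (`IV` with `c₃(G′) = 1`): the 3-adic term is exactly `1`.
[cite: MazurRubin2015SelmerCompanions, §2–§3 (arXiv:1203.0620)]
[evidence: census cell O5, o5-r1 GEN 12, P-K18 kit j141165, K18-d on the 9 139 kept pairs of these types (potmult 4 069, potord 3 348, II k=0 900, IV k=2 822): 0 violations at D_α⁺ − 1; 2 642 of them are inconsistent with D_α⁺ − 2 (the unit is necessary) — T29 doc §3] -/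
@[conjecture] def SelmerTransferOddPairThree : Prop :=
  ∀ (W G : WeierstrassCurve ℚ) [W.IsElliptic] [W.IsGloballyMinimal] [G.IsElliptic] [G.IsGloballyMinimal],
    W.HasIrreducibleModPGaloisRep 3 → IsCongruentModThree W G →
    numStableLinesAtThree W = 1 → numStableLinesAtThree G = 1 →
    HasFlatLineKummerImageAtThree W → (HasTrivialKummerImageAtThree G ∨ HasFullKummerImageAtThree G) →
      selmerDimThree W ≤ selmerDimThree G + (betaBudgetThree W G + 1) ∧
        selmerDimThree G ≤ selmerDimThree W + (betaBudgetThree W G + 1)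

/-- **T29.7 (b) `RamifiedLineKummerImageTypeIVThree` (EVIDENCE law, o5-r1 GEN 12; companions only — O6 owns wild rows).**
A 3-WILD curve of Kodaira type IV (`f₃ = 4`, `v₃Δ = 6`) with one stable line, a rational 3-torsion point and `k = 1`
(equivalently `c₃(G′) = 3`) has a TRÈS RAMIFIÉ Kummer line (`t ∈ {⟨3⟩, ⟨6⟩, ⟨12⟩}`, never `U`); measured finer law (post hoc,
held-out validated 233/233): `t = ⟨12 · (c₆/3⁵)²⟩`.  Consequence: `W(III) ~ G(IV, c′ = 3)` costs the full `2` (T27 is sharp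
there; 99 such pairs NEED cost 2 by the BSD-read data).  Typed census-decidably as: flat image impossible when a ramified
value exists and no unit value exists — recorded as the DATUM predicate only (no Kodaira-IV predicate in the tree yet).
[evidence: census cell O5, o5-r1 GEN 12, P-K18 kit j141165: 500/500 class-01 IV curves with c₃(G′) = 3 have t ∈ {R0 173, R1 153, R2 174}, c₆/3⁵ mod 9 = 4, 7, 1 respectively (FIT 267 / VALIDATE 233, 0 disagreements); 502/502 with c₃(G′) = 1 have k = 2 — T29 doc §3] -/
@[conjecture] def RamifiedLineNeverFlatThree : Prop :=
  ∀ (G : WeierstrassCurve ℚ), HasRamifiedLineKummerImageAtThree G → ¬ HasFlatLineKummerImageAtThree G →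
    ∀ x₀ y₀ : ℚ_[3], IsRationalThreeTorsionPointAtThree G x₀ y₀ → KummerImageHasRamifiedAtThree G x₀ y₀ →
      ¬ (KummerImageFlatAtThree G x₀ y₀)

/-- The datum predicates are consistent: a ramified value refutes flatness at the same base point (PROVED, definitional). [folklore] -/
theorem ramifiedLineNeverFlatThree_holds : RamifiedLineNeverFlatThree := by
  intro G _ _ x₀ y₀ _ hram hflat
  obtain ⟨x, y, hxy, hx, hv⟩ := hram
  exact hv (hflat x y hxy hx).2

/-! ## §3 PROVED links: the laws the census cell uses, from the nodes above -/

/-- **III ~ III (and every (1,U) ~ (1,U)) costs NOTHING at 3** — from the γ = 0 pair law and the flat-line law T29.6: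
two congruent O5(t′) type-III class-01 curves have 3-Selmer dimensions within the away-from-3 budget of each other.
PROVED bookkeeping (o5-r1 GEN 12). [folklore] -/
theorem selmerTransfer_typeIII_pair_of (hP : SelmerTransferFlatPairThree) (hF : FlatKummerImageTypeIIIThree)
    (W G : WeierstrassCurve ℚ) [W.IsElliptic] [W.IsGloballyMinimal] [G.IsElliptic] [G.IsGloballyMinimal]
    (hirr : W.HasIrreducibleModPGaloisRep 3) (hcong : IsCongruentModThree W G)
    (h5W : ClassO5 W 3) (htW : SubTprime W 3) (hΔW : padicValRat 3 W.Δ = 3) (h1W : numStableLinesAtThree W = 1)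
    (h0W : HasRationalThreeTorsionAtThree W)
    (h5G : ClassO5 G 3) (htG : SubTprime G 3) (hΔG : padicValRat 3 G.Δ = 3) (h1G : numStableLinesAtThree G = 1)
    (h0G : HasRationalThreeTorsionAtThree G) :
    selmerDimThree W ≤ selmerDimThree G + betaBudgetThree W G ∧
      selmerDimThree G ≤ selmerDimThree W + betaBudgetThree W G := by
  obtain ⟨x₀, y₀, hP₀⟩ := h0W
  obtain ⟨x₁, y₁, hP₁⟩ := h0G
  have hW : HasFlatLineKummerImageAtThree W := ⟨x₀, y₀, hP₀, hF W h5W htW hΔW h1W x₀ y₀ hP₀⟩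
  have hG : HasFlatLineKummerImageAtThree G := ⟨x₁, y₁, hP₁, hF G h5G htG hΔG h1G x₁ y₁ hP₁⟩
  exact hP W G hirr hcong h1W h1G hW hG

/-- **III ~ (Iₙ* or I₀*-ordinary) costs EXACTLY ONE at 3** (`D_λ = D_α⁺ − 1`, one unit better than T27 for free) — from the
γ = 1 pair law, T29.6 and T29.4 (b2)/(b3).  PROVED bookkeeping (o5-r1 GEN 12). [folklore] -/
theorem selmerTransfer_typeIII_potTwist_of (hP : SelmerTransferOddPairThree) (hF : FlatKummerImageTypeIIIThree)
    (hT : TrivialKummerImagePotTwistThree)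
    (W G : WeierstrassCurve ℚ) [W.IsElliptic] [W.IsGloballyMinimal] [G.IsElliptic] [G.IsGloballyMinimal]
    (hirr : W.HasIrreducibleModPGaloisRep 3) (hcong : IsCongruentModThree W G)
    (h5W : ClassO5 W 3) (htW : SubTprime W 3) (hΔW : padicValRat 3 W.Δ = 3) (h1W : numStableLinesAtThree W = 1)
    (h0W : HasRationalThreeTorsionAtThree W)
    (haG : Addv G 3) (hMG : SubM G 3 ∨ SubGordOrd G 3) (h1G : numStableLinesAtThree G = 1)
    (h0G : HasRationalThreeTorsionAtThree G) :
    selmerDimThree W ≤ selmerDimThree G + (betaBudgetThree W G + 1) ∧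
      selmerDimThree G ≤ selmerDimThree W + (betaBudgetThree W G + 1) := by
  obtain ⟨x₀, y₀, hP₀⟩ := h0W
  obtain ⟨x₁, y₁, hP₁⟩ := h0G
  have hW : HasFlatLineKummerImageAtThree W := ⟨x₀, y₀, hP₀, hF W h5W htW hΔW h1W x₀ y₀ hP₀⟩
  have hG : HasTrivialKummerImageAtThree G := ⟨x₁, y₁, hP₁, hT G haG hMG h1G x₁ y₁ hP₁⟩
  exact hP W G hirr hcong h1W h1G hW (Or.inl hG)

/-! ## §4 The cost table (T29.2) as a function, with its values checked by `decide` -/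

/-- The Lagrangian datum of a class-01 curve at `3`, as the census reads it: `zero` (`k = 0`), `flat` (`k = 1`, `t = U`),
`ram i` (`k = 1`, `t = ⟨3·2^i⟩`), `plane` (`k = 2`). [folklore] -/
inductive LagDatumThree
  | zero
  | flat
  | ram (i : Fin 3)
  | plane
  deriving DecidableEq, Repr, Fintype

namespace LagDatumThree

/-- `k` = `dim t` = `2 − dim(κ ∩ L_C)`. [folklore] -/
def k : LagDatumThree → ℕ
  | zero => 0
  | flat => 1
  | ram _ => 1
  | plane => 2

/-- **T29.2**: the exact 3-adic cost `dim κ_W − dim(κ_W ∩ κ_G)`; `none` = undecided by the data (both `k = 2`). [folklore] -/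
def cost : LagDatumThree → LagDatumThree → Option ℕ
  | plane, plane => none
  | a, b =>
    if a.k = b.k then (if a = b then some 0 else some 2)
    else if a.k + b.k = 2 then some 2 else some 1

/-- The table is symmetric. [folklore] -/
theorem cost_comm : ∀ a b : LagDatumThree, cost a b = cost b a := by decide

/-- The cost never exceeds T27's crude `1 + h⁰₃ = 2`. [folklore] -/
theorem cost_le_two : ∀ a b : LagDatumThree, ∀ c ∈ cost a b, c ≤ 2 := by decide

/-- **γ**, the census values for a type-III row (`flat`) against each companion type:
III / II(c′=1) ↦ 0, Iₙ* / I₀* / II(c′=3) ↦ 1, IV(c′=1) ↦ 1, IV(c′=3) ↦ 2. [folklore] -/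
theorem cost_flat_table :
    cost flat flat = some 0 ∧ cost flat zero = some 1 ∧ cost flat plane = some 1 ∧
      (∀ i, cost flat (ram i) = some 2) := by decide

/-- Parity rule behind the table (Lemma L: two Lagrangians lie in the same ruling iff their intersection has EVEN
codimension, and the ruling of `κ` is the parity of `k`): `cost ≡ k + k' (mod 2)`. [folklore] -/
theorem cost_parity : ∀ a b : LagDatumThree, ∀ c ∈ cost a b, c % 2 = (a.k + b.k) % 2 := by decide

end LagDatumThree

end Summit.BirchSwinnertonDyer.Rank1Residual.O5

end
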